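import Summits.NavierStokesRegularity.FluidComputer.PalasekTowerCompactionBudget
import Literature.Analysis.FluidPDE.LundgrenCrossSectionMoments

/-!
# REGISTER v2.3″: the window laws of a Lundgren-carried child core of ARBITRARY cross-section —
# compaction budget (N-2′ exact, any profile), vorticity amplification ≤ stretch, swirl speed ≤ √stretch,
# peak vorticity ≥ ΓλA_k/(8πρ) after the budget

Cell `ns-blowup`, seat `ns-blowup-ecbridge-8` (g5); evidence toward the readout / a-priori side of the
cruxes 19250 `HeredityFromTwo` (stubs `stub_core_floors`, `stub_speed_floors`, `stub_apriori_ceiling`)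
and 19249 / 19179 of route `PalasekTowerBreakdown`. It extends REGISTER v2.3′
(`PalasekTowerCompactionBudget`, ecbridge-8 g4: the compaction budget of a strained GAUSSIAN child core)
to an ARBITRARY child cross-section, using the Literature theorems of `LundgrenCrossSectionMoments`
(ecbridge-8 g5: Saffman §13.3 (26)–(31) ∘ Majda–Bertozzi Prop. 1.14 / §3.3 / (8.27)).

MODEL IDENTIFICATION (as in v2.3′, parts 1–3): «during a run-up of duration `t` inside the window
`k → k+1` the child core is a cross-section of Lundgren's stretched flow in the host strain
`c = λ·A_k` at `ν = 1`: `u = c·Dx + e^{ct/2} ṽ(T(t), e^{ct/2}x̃) (+ an axial passive part)`,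
`T(t) = (e^{ct} − 1)/c`, with `(ṽ, p̃)` a classical planar Navier–Stokes solution of ANY profile whose
vorticity decays rapidly and whose velocity is `K₂ ∗ ω̃`». The EFFECTIVE CORE PARAMETER of a
cross-section is `s_eff = M/(4Γ)` (`M = ∫|y|²ω_z dy`, `Γ = ∫ω_z dy`; for the Gaussian
`Γ(4πs)⁻¹e^{−|y|²/4s}` it is `s`).

* `palasekTowerBreakdown_childCore_anyProfile_eq` — **`s_eff(t) = strainedCoreRadiusSq (λA_k) 1 s_eff(0) t`
  EXACTLY**: the Gaussian core law of v2.3′ holds for the effective core parameter of any profile, so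
  the dictionary `λ ↦ λ_eff` (`_effectiveStrainFactor`) and everything in §1–§2 of v2.3′ apply with
  `s₀ := s_eff(0)`;
* `palasekTowerBreakdown_compaction_budget_iff_anyProfile` — **N-2′ FOR ANY PROFILE**: the child has
  compacted to within `ρ` Burgers areas, `s_eff(t) ≤ ρ/(λA_k)`, iff the run-up delivered
  `λA_k t ≥ log((s_eff(0)λA_k − 1)/(ρ − 1))` host strain-times (same budget as v2.3′
  `_compaction_budget_iff`, now a theorem about the flow, not about a chosen profile);
* `palasekTowerBreakdown_childVorticity_le_stretch_anyProfile` — the CEILING companion: the child's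
  peak axial vorticity grows at most by the accumulated stretch, `|ω_z(t, ·)| ≤ e^{λA_k(t − t₀)}·B`;
* `palasekTowerBreakdown_childSwirl_le_sqrtStretch_anyProfile` — for a co-signed child
  (`ω_z(0, ·) ≥ 0`, `≤ B`): the peak swirl speed grows at most like the square root of the stretch,
  `‖e^{ct/2}ṽ(T(t), e^{ct/2}y)‖ ≤ e^{ct/2} · 2(BΓ/2π)^{1/2}`.
* `palasekTowerBreakdown_childPeak_floor_of_budget_anyProfile` — the FLOOR companion: for a
  co-signed child with `Γ > 0`, once the N-2′ budget is delivered every bound `ω_z(t, ·) ≤ A`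
  has `A ≥ ΓλA_k/(8πρ)` (half the Burgers peak `ΓλA_k/(4π)` up to the tolerance `ρ`) — Lieb–Loss's
  bathtub principle (the Rankine section minimises `∫|y|²ω_z` at given peak and circulation) through
  Lundgren's map (`Lundgren.curl_lundgren_const_peak_floor_of_budget`, ecbridge-8 g5).

WHAT THIS IS NOT: not NS about any registered flow — the Lundgren flows are exact INFINITE-ENERGY
solutions (unbounded strain part) and no registered stage; nothing is asserted about `ReadoutFloors`,
`AprioriCeiling` or any crux; the identification «child core = Lundgren cross-section» is a MODEL step.

References: P. G. Saffman, *Vortex Dynamics*, CUP 1992, §13.3 (26)–(31) [cite: Saffman1992, §13.3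
eqs. (26)–(31)]; A. J. Majda, A. L. Bertozzi, CUP 2002, §1.7 Prop. 1.14, §3.3, §8.2.3 (8.27)
[cite: MajdaBertozziCUP2002, §1.7 Prop. 1.14]; E. H. Lieb, M. Loss, *Analysis*, AMS 2001, Thm. 1.14
[cite: LiebLoss2001, Thm. 1.14]; S. Palasek, arXiv:2605.13827, §3 (3.2)
[cite: Palasek2026ElementaryModel, §3 (3.2)].
-/

namespace Summit.NavierStokesRegularity.FluidComputer.PalasekTowerClayBridge

open Real Set MeasureTheory
open Literature.Analysis.FluidPDE Literature.Analysis.FluidPDE.Lundgren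

variable {S S' : Set ℝ}
  {v : ℝ → EuclideanSpace ℝ (Fin 2) → EuclideanSpace ℝ (Fin 2)}
  {q : ℝ → EuclideanSpace ℝ (Fin 2) → ℝ} {w : ℝ → EuclideanSpace ℝ (Fin 2) → ℝ}

/-- **The effective core parameter of an arbitrary child cross-section obeys the strained-Gaussian
core law of REGISTER v2.3′ exactly** (`ν = 1`, host strain `λA_k`, run-up `t` from the window start
`0 ∈ S`): `s_eff(t, z) = strainedCoreRadiusSq (λA_k) 1 s_eff(0, z₀) t`. -/
theorem palasekTowerBreakdown_childCore_anyProfile_eq (R : TowerRates) (k : ℕ) {l : ℝ} (hl : 0 < l)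
    (hS' : Convex ℝ S') (hv : IsClassicalNSSolutionOn S' 1 0 v q)
    (hω : HasUniformRapidDecayOn S' (fun σ η => PlanarEigenmode.vorticity (v σ) η))
    (hBS : ∀ σ ∈ S', ∀ η, v σ η = biotSavart2D (PlanarEigenmode.vorticity (v σ)) η)
    (hw : IsSmoothSpaceTimeOn S' w)
    (hmaps : MapsTo (fun t => (exp (l * R.A k * t) - 1) / (l * R.A k)) S S') (h0 : (0 : ℝ) ∈ S)
    {t : ℝ} (ht : t ∈ S) (z₀ z : ℝ)
    (hΓ : (∫ y : EuclideanSpace ℝ (Fin 2),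
      curl (velocity (fun _ => l * R.A k)
        (fun t y => exp (l * R.A k * t / 2) •
          v ((exp (l * R.A k * t) - 1) / (l * R.A k)) (exp (l * R.A k * t / 2) • y))
        (fun t y => exp (-(l * R.A k * t)) •
          w ((exp (l * R.A k * t) - 1) / (l * R.A k)) (exp (l * R.A k * t / 2) • y)) 0)
        (embedXY y + z₀ • eZ) 2) ≠ 0) :
    (∫ y : EuclideanSpace ℝ (Fin 2), ‖y‖ ^ 2 *
        curl (velocity (fun _ => l * R.A k)
          (fun t y => exp (l * R.A k * t / 2) •
            v ((exp (l * R.A k * t) - 1) / (l * R.A k)) (exp (l * R.A k * t / 2) • y))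
          (fun t y => exp (-(l * R.A k * t)) •
            w ((exp (l * R.A k * t) - 1) / (l * R.A k)) (exp (l * R.A k * t / 2) • y)) t)
          (embedXY y + z • eZ) 2) /
        (4 * ∫ y : EuclideanSpace ℝ (Fin 2),
          curl (velocity (fun _ => l * R.A k)
            (fun t y => exp (l * R.A k * t / 2) •
              v ((exp (l * R.A k * t) - 1) / (l * R.A k)) (exp (l * R.A k * t / 2) • y))
            (fun t y => exp (-(l * R.A k * t)) •
              w ((exp (l * R.A k * t) - 1) / (l * R.A k)) (exp (l * R.A k * t / 2) • y)) 0)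
            (embedXY y + z₀ • eZ) 2) =
      RadialEddy.strainedCoreRadiusSq (l * R.A k) 1
        ((∫ y : EuclideanSpace ℝ (Fin 2), ‖y‖ ^ 2 *
          curl (velocity (fun _ => l * R.A k)
            (fun t y => exp (l * R.A k * t / 2) •
              v ((exp (l * R.A k * t) - 1) / (l * R.A k)) (exp (l * R.A k * t / 2) • y))
            (fun t y => exp (-(l * R.A k * t)) •
              w ((exp (l * R.A k * t) - 1) / (l * R.A k)) (exp (l * R.A k * t / 2) • y)) 0)
            (embedXY y + z₀ • eZ) 2) /
          (4 * ∫ y : EuclideanSpace ℝ (Fin 2),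
            curl (velocity (fun _ => l * R.A k)
              (fun t y => exp (l * R.A k * t / 2) •
                v ((exp (l * R.A k * t) - 1) / (l * R.A k)) (exp (l * R.A k * t / 2) • y))
              (fun t y => exp (-(l * R.A k * t)) •
                w ((exp (l * R.A k * t) - 1) / (l * R.A k)) (exp (l * R.A k * t / 2) • y)) 0)
              (embedXY y + z₀ • eZ) 2)) t :=
  effectiveCore_lundgren_const_eq (mul_pos hl (R.A_pos k)).ne' hS' hv hω hBS hw hmaps h0 ht z₀ z hΓ

/-- **N-2′ FOR ANY PROFILE — the compaction budget of an arbitrary child cross-section** (`ν = 1`,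
host strain `λA_k`, tolerance `ρ > 1`, initial cross-section fatter than the tolerated core,
`ρ < s_eff(0, z₀)·λA_k`): after the run-up `t ∈ S` the child has compacted to within `ρ` Burgers
areas, `s_eff(t, z) ≤ ρ/(λA_k)`, if and only if the run-up delivered
`λA_k t ≥ log((s_eff(0, z₀)λA_k − 1)/(ρ − 1))` host strain-times — the same closed-form budget as for
the Gaussian core (`palasekTowerBreakdown_compaction_budget_iff`), for every profile. -/
theorem palasekTowerBreakdown_compaction_budget_iff_anyProfile (R : TowerRates) (k : ℕ) {l : ℝ}
    (hl : 0 < l) (hS' : Convex ℝ S') (hv : IsClassicalNSSolutionOn S' 1 0 v q)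
    (hω : HasUniformRapidDecayOn S' (fun σ η => PlanarEigenmode.vorticity (v σ) η))
    (hBS : ∀ σ ∈ S', ∀ η, v σ η = biotSavart2D (PlanarEigenmode.vorticity (v σ)) η)
    (hw : IsSmoothSpaceTimeOn S' w)
    (hmaps : MapsTo (fun t => (exp (l * R.A k * t) - 1) / (l * R.A k)) S S') (h0 : (0 : ℝ) ∈ S)
    {t : ℝ} (ht : t ∈ S) (z₀ z : ℝ)
    (hΓ : (∫ y : EuclideanSpace ℝ (Fin 2),
      curl (velocity (fun _ => l * R.A k)
        (fun t y => exp (l * R.A k * t / 2) •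
          v ((exp (l * R.A k * t) - 1) / (l * R.A k)) (exp (l * R.A k * t / 2) • y))
        (fun t y => exp (-(l * R.A k * t)) •
          w ((exp (l * R.A k * t) - 1) / (l * R.A k)) (exp (l * R.A k * t / 2) • y)) 0)
        (embedXY y + z₀ • eZ) 2) ≠ 0)
    {ρ : ℝ} (hρ : 1 < ρ)
    (hfat : ρ * (1 / (l * R.A k)) <
      (∫ y : EuclideanSpace ℝ (Fin 2), ‖y‖ ^ 2 *
          curl (velocity (fun _ => l * R.A k)
            (fun t y => exp (l * R.A k * t / 2) •
              v ((exp (l * R.A k * t) - 1) / (l * R.A k)) (exp (l * R.A k * t / 2) • y))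
            (fun t y => exp (-(l * R.A k * t)) •
              w ((exp (l * R.A k * t) - 1) / (l * R.A k)) (exp (l * R.A k * t / 2) • y)) 0)
            (embedXY y + z₀ • eZ) 2) /
        (4 * ∫ y : EuclideanSpace ℝ (Fin 2),
          curl (velocity (fun _ => l * R.A k)
            (fun t y => exp (l * R.A k * t / 2) •
              v ((exp (l * R.A k * t) - 1) / (l * R.A k)) (exp (l * R.A k * t / 2) • y))
            (fun t y => exp (-(l * R.A k * t)) •
              w ((exp (l * R.A k * t) - 1) / (l * R.A k)) (exp (l * R.A k * t / 2) • y)) 0)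
            (embedXY y + z₀ • eZ) 2)) :
    (∫ y : EuclideanSpace ℝ (Fin 2), ‖y‖ ^ 2 *
        curl (velocity (fun _ => l * R.A k)
          (fun t y => exp (l * R.A k * t / 2) •
            v ((exp (l * R.A k * t) - 1) / (l * R.A k)) (exp (l * R.A k * t / 2) • y))
          (fun t y => exp (-(l * R.A k * t)) •
            w ((exp (l * R.A k * t) - 1) / (l * R.A k)) (exp (l * R.A k * t / 2) • y)) t)
          (embedXY y + z • eZ) 2) /
        (4 * ∫ y : EuclideanSpace ℝ (Fin 2),
          curl (velocity (fun _ => l * R.A k)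
            (fun t y => exp (l * R.A k * t / 2) •
              v ((exp (l * R.A k * t) - 1) / (l * R.A k)) (exp (l * R.A k * t / 2) • y))
            (fun t y => exp (-(l * R.A k * t)) •
              w ((exp (l * R.A k * t) - 1) / (l * R.A k)) (exp (l * R.A k * t / 2) • y)) 0)
            (embedXY y + z₀ • eZ) 2) ≤ ρ * (1 / (l * R.A k)) ↔
      log (((∫ y : EuclideanSpace ℝ (Fin 2), ‖y‖ ^ 2 *
            curl (velocity (fun _ => l * R.A k)
              (fun t y => exp (l * R.A k * t / 2) •
                v ((exp (l * R.A k * t) - 1) / (l * R.A k)) (exp (l * R.A k * t / 2) • y))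
              (fun t y => exp (-(l * R.A k * t)) •
                w ((exp (l * R.A k * t) - 1) / (l * R.A k)) (exp (l * R.A k * t / 2) • y)) 0)
              (embedXY y + z₀ • eZ) 2) /
          (4 * ∫ y : EuclideanSpace ℝ (Fin 2),
            curl (velocity (fun _ => l * R.A k)
              (fun t y => exp (l * R.A k * t / 2) •
                v ((exp (l * R.A k * t) - 1) / (l * R.A k)) (exp (l * R.A k * t / 2) • y))
              (fun t y => exp (-(l * R.A k * t)) •
                w ((exp (l * R.A k * t) - 1) / (l * R.A k)) (exp (l * R.A k * t / 2) • y)) 0)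
              (embedXY y + z₀ • eZ) 2) * (l * R.A k) - 1) / (ρ - 1)) ≤ l * R.A k * t := by
  have hγ : 0 < l * R.A k := mul_pos hl (R.A_pos k)
  have h := effectiveCore_lundgren_const_le_iff hγ one_pos hS' hv hω hBS hw hmaps h0 ht z₀ z hΓ hρ
    hfat
  rw [h, div_div_eq_mul_div, div_one]

/-- **The child's peak axial vorticity grows at most by the accumulated stretch** (`ν = 1`, host
strain `λA_k > 0`, planar vorticity decaying near spatial infinity uniformly on `S̃`, times
`t₀ ≤ t` in `S`): `|ω_z(t₀, ·)| ≤ B` on `ℝ³` implies `|ω_z(t, ·)| ≤ e^{λA_k(t − t₀)}·B` — the CEILING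
companion of the compaction floor, for any profile (Saffman (29) with the maximum principle for the
planar vorticity). -/
theorem palasekTowerBreakdown_childVorticity_le_stretch_anyProfile (R : TowerRates) (k : ℕ) {l : ℝ}
    (hl : 0 < l) (hS' : Convex ℝ S') (hv : IsClassicalNSSolutionOn S' 1 0 v q)
    (hdec : ∀ δ : ℝ, 0 < δ → ∃ ρ : ℝ, ∀ σ ∈ S', ∀ η : EuclideanSpace ℝ (Fin 2),
      ρ ≤ ‖η‖ → |PlanarEigenmode.vorticity (v σ) η| ≤ δ)
    (hw : IsSmoothSpaceTimeOn S' w)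
    (hmaps : MapsTo (fun t => (exp (l * R.A k * t) - 1) / (l * R.A k)) S S') {t₀ t : ℝ}
    (ht₀ : t₀ ∈ S) (ht : t ∈ S) (htt : t₀ ≤ t) {B : ℝ}
    (hB : ∀ x : EuclideanSpace ℝ (Fin 3),
      |curl (velocity (fun _ => l * R.A k)
        (fun t y => exp (l * R.A k * t / 2) •
          v ((exp (l * R.A k * t) - 1) / (l * R.A k)) (exp (l * R.A k * t / 2) • y))
        (fun t y => exp (-(l * R.A k * t)) •
          w ((exp (l * R.A k * t) - 1) / (l * R.A k)) (exp (l * R.A k * t / 2) • y)) t₀) x 2| ≤ B)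
    (x : EuclideanSpace ℝ (Fin 3)) :
    |curl (velocity (fun _ => l * R.A k)
        (fun t y => exp (l * R.A k * t / 2) •
          v ((exp (l * R.A k * t) - 1) / (l * R.A k)) (exp (l * R.A k * t / 2) • y))
        (fun t y => exp (-(l * R.A k * t)) •
          w ((exp (l * R.A k * t) - 1) / (l * R.A k)) (exp (l * R.A k * t / 2) • y)) t) x 2| ≤
      exp (l * R.A k * (t - t₀)) * B :=
  abs_curl_lundgren_const_le_exp_mul (mul_pos hl (R.A_pos k)) hS' zero_le_one hv hdec hw hmaps ht₀ ht
    htt hB x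

/-- **The child's peak swirl speed grows at most like the square root of the stretch** (`ν = 1`, host
strain `λA_k > 0`, window start `0 ∈ S`, `t ≥ 0` in `S`, co-signed child: axial vorticity at time `0`
non-negative and `≤ B` with `B > 0`, cross-section circulation `Γ`):
`‖e^{ct/2} ṽ(T(t), e^{ct/2} y)‖ ≤ e^{ct/2} · 2 (BΓ/2π)^{1/2}`, `c = λA_k` — MB (8.27) at Lundgren
time, uniform in time by the maximum principle and Kelvin, read through Saffman (29). -/
theorem palasekTowerBreakdown_childSwirl_le_sqrtStretch_anyProfile (R : TowerRates) (k : ℕ) {l : ℝ}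
    (hl : 0 < l) (hS' : Convex ℝ S') (hv : IsClassicalNSSolutionOn S' 1 0 v q)
    (hω : HasUniformRapidDecayOn S' (fun σ η => PlanarEigenmode.vorticity (v σ) η))
    (hBS : ∀ σ ∈ S', ∀ η, v σ η = biotSavart2D (PlanarEigenmode.vorticity (v σ)) η)
    (hw : IsSmoothSpaceTimeOn S' w)
    (hmaps : MapsTo (fun t => (exp (l * R.A k * t) - 1) / (l * R.A k)) S S') (h0 : (0 : ℝ) ∈ S)
    {t : ℝ} (ht : t ∈ S) (htt : 0 ≤ t)
    (hpos : ∀ x : EuclideanSpace ℝ (Fin 3), 0 ≤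
      curl (velocity (fun _ => l * R.A k)
        (fun t y => exp (l * R.A k * t / 2) •
          v ((exp (l * R.A k * t) - 1) / (l * R.A k)) (exp (l * R.A k * t / 2) • y))
        (fun t y => exp (-(l * R.A k * t)) •
          w ((exp (l * R.A k * t) - 1) / (l * R.A k)) (exp (l * R.A k * t / 2) • y)) 0) x 2)
    {B : ℝ} (hB0 : 0 < B)
    (hB : ∀ x : EuclideanSpace ℝ (Fin 3),
      curl (velocity (fun _ => l * R.A k)
        (fun t y => exp (l * R.A k * t / 2) •
          v ((exp (l * R.A k * t) - 1) / (l * R.A k)) (exp (l * R.A k * t / 2) • y))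
        (fun t y => exp (-(l * R.A k * t)) •
          w ((exp (l * R.A k * t) - 1) / (l * R.A k)) (exp (l * R.A k * t / 2) • y)) 0) x 2 ≤ B)
    (z₀ : ℝ) (y : EuclideanSpace ℝ (Fin 2)) :
    ‖exp (l * R.A k * t / 2) •
        v ((exp (l * R.A k * t) - 1) / (l * R.A k)) (exp (l * R.A k * t / 2) • y)‖ ≤
      exp (l * R.A k * t / 2) * (2 * Real.sqrt (B *
        (∫ y' : EuclideanSpace ℝ (Fin 2),
          curl (velocity (fun _ => l * R.A k)
            (fun t y => exp (l * R.A k * t / 2) •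
              v ((exp (l * R.A k * t) - 1) / (l * R.A k)) (exp (l * R.A k * t / 2) • y))
            (fun t y => exp (-(l * R.A k * t)) •
              w ((exp (l * R.A k * t) - 1) / (l * R.A k)) (exp (l * R.A k * t / 2) • y)) 0)
            (embedXY y' + z₀ • eZ) 2) / (2 * Real.pi))) := by
  have hγ : 0 < l * R.A k := mul_pos hl (R.A_pos k)
  have hτ : (exp (l * R.A k * 0) - 1) / (l * R.A k) ≤ (exp (l * R.A k * t) - 1) / (l * R.A k) := by
    refine div_le_div_of_nonneg_right ?_ hγ.le
    exact sub_le_sub_right (exp_le_exp.2 (mul_le_mul_of_nonneg_left htt hγ.le)) 1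
  have h := norm_swirl_lundgren_le_sqrt (γ := fun _ => l * R.A k)
    (a := fun t => exp (l * R.A k * t / 2)) (τ := fun t => (exp (l * R.A k * t) - 1) / (l * R.A k))
    (d := fun t => exp (-(l * R.A k * t))) hS' zero_le_one hv hω hBS hw hmaps h0 ht hτ
    (exp_pos _).ne' hpos hB0 hB z₀ y
  simp only [mul_zero, zero_div, exp_zero, one_pow, div_one, abs_of_pos (exp_pos _)] at h
  exact h

/-- **THE CHILD'S PEAK FLOOR AFTER THE BUDGET, FOR ANY PROFILE** (`ν = 1`, host strain `λA_k`,
tolerance `ρ > 1`; a co-signed child cross-section, `ω_z(0, ·) ≥ 0` on `ℝ³`, with circulation `Γ > 0`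
and effective core `s_eff(0, z₀)` fatter than the tolerated one, `ρ < s_eff(0, z₀)·λA_k`): once the
run-up `t ≥ 0` (`0, t ∈ S`) has delivered the N-2′ budget,
`λA_k t ≥ log((s_eff(0, z₀)λA_k − 1)/(ρ − 1))`, EVERY pointwise bound `ω_z(t, ·) ≤ A` of the child's
axial vorticity satisfies **`Γ·λA_k/(8πρ) ≤ A`** — the child's peak is at least one half of the
Burgers-vortex peak `ΓλA_k/(4π)` up to the tolerance, whatever the profile: the compaction
`s_eff(t, z) ≤ ρ/(λA_k)` (`_compaction_budget_iff_anyProfile`) fed into the bathtub floor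
`A ≥ Γ/(8π s_eff(t, z))` (Lieb–Loss Thm. 1.14 with the weight `|y|²`, through Lundgren's map:
`Lundgren.curl_lundgren_const_peak_floor_of_budget`). The FLOOR companion of
`_childVorticity_le_stretch_anyProfile`. -/
theorem palasekTowerBreakdown_childPeak_floor_of_budget_anyProfile (R : TowerRates) (k : ℕ) {l : ℝ}
    (hl : 0 < l) (hS' : Convex ℝ S') (hv : IsClassicalNSSolutionOn S' 1 0 v q)
    (hω : HasUniformRapidDecayOn S' (fun σ η => PlanarEigenmode.vorticity (v σ) η))
    (hBS : ∀ σ ∈ S', ∀ η, v σ η = biotSavart2D (PlanarEigenmode.vorticity (v σ)) η)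
    (hw : IsSmoothSpaceTimeOn S' w)
    (hmaps : MapsTo (fun t => (exp (l * R.A k * t) - 1) / (l * R.A k)) S S') (h0 : (0 : ℝ) ∈ S)
    {t : ℝ} (ht : t ∈ S) (ht0 : 0 ≤ t) (z₀ z : ℝ)
    (hpos : ∀ x : EuclideanSpace ℝ (Fin 3), 0 ≤ curl (velocity (fun _ => l * R.A k)
          (fun t y => exp (l * R.A k * t / 2) •
            v ((exp (l * R.A k * t) - 1) / (l * R.A k)) (exp (l * R.A k * t / 2) • y))
          (fun t y => exp (-(l * R.A k * t)) •
            w ((exp (l * R.A k * t) - 1) / (l * R.A k)) (exp (l * R.A k * t / 2) • y)) 0) x 2)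
    (hΓ : 0 < ∫ y : EuclideanSpace ℝ (Fin 2),
        curl (velocity (fun _ => l * R.A k)
          (fun t y => exp (l * R.A k * t / 2) •
            v ((exp (l * R.A k * t) - 1) / (l * R.A k)) (exp (l * R.A k * t / 2) • y))
          (fun t y => exp (-(l * R.A k * t)) •
            w ((exp (l * R.A k * t) - 1) / (l * R.A k)) (exp (l * R.A k * t / 2) • y)) 0)
          (embedXY y + z₀ • eZ) 2)
    {ρ : ℝ} (hρ : 1 < ρ)
    (hfat : ρ * (1 / (l * R.A k)) < (∫ y : EuclideanSpace ℝ (Fin 2), ‖y‖ ^ 2 *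
        curl (velocity (fun _ => l * R.A k)
          (fun t y => exp (l * R.A k * t / 2) •
            v ((exp (l * R.A k * t) - 1) / (l * R.A k)) (exp (l * R.A k * t / 2) • y))
          (fun t y => exp (-(l * R.A k * t)) •
            w ((exp (l * R.A k * t) - 1) / (l * R.A k)) (exp (l * R.A k * t / 2) • y)) 0)
          (embedXY y + z₀ • eZ) 2) /
        (4 * ∫ y : EuclideanSpace ℝ (Fin 2),
          curl (velocity (fun _ => l * R.A k)
          (fun t y => exp (l * R.A k * t / 2) •
            v ((exp (l * R.A k * t) - 1) / (l * R.A k)) (exp (l * R.A k * t / 2) • y))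
          (fun t y => exp (-(l * R.A k * t)) •
            w ((exp (l * R.A k * t) - 1) / (l * R.A k)) (exp (l * R.A k * t / 2) • y)) 0)
          (embedXY y + z₀ • eZ) 2))
    (hbud : log (((∫ y : EuclideanSpace ℝ (Fin 2), ‖y‖ ^ 2 *
        curl (velocity (fun _ => l * R.A k)
          (fun t y => exp (l * R.A k * t / 2) •
            v ((exp (l * R.A k * t) - 1) / (l * R.A k)) (exp (l * R.A k * t / 2) • y))
          (fun t y => exp (-(l * R.A k * t)) •
            w ((exp (l * R.A k * t) - 1) / (l * R.A k)) (exp (l * R.A k * t / 2) • y)) 0)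
          (embedXY y + z₀ • eZ) 2) /
        (4 * ∫ y : EuclideanSpace ℝ (Fin 2),
          curl (velocity (fun _ => l * R.A k)
          (fun t y => exp (l * R.A k * t / 2) •
            v ((exp (l * R.A k * t) - 1) / (l * R.A k)) (exp (l * R.A k * t / 2) • y))
          (fun t y => exp (-(l * R.A k * t)) •
            w ((exp (l * R.A k * t) - 1) / (l * R.A k)) (exp (l * R.A k * t / 2) • y)) 0)
          (embedXY y + z₀ • eZ) 2) * (l * R.A k) - 1) / (ρ - 1)) ≤ l * R.A k * t)
    {A : ℝ} (hA : ∀ x : EuclideanSpace ℝ (Fin 3), curl (velocity (fun _ => l * R.A k)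
          (fun t y => exp (l * R.A k * t / 2) •
            v ((exp (l * R.A k * t) - 1) / (l * R.A k)) (exp (l * R.A k * t / 2) • y))
          (fun t y => exp (-(l * R.A k * t)) •
            w ((exp (l * R.A k * t) - 1) / (l * R.A k)) (exp (l * R.A k * t / 2) • y)) t) x 2 ≤ A) :
    (∫ y : EuclideanSpace ℝ (Fin 2),
        curl (velocity (fun _ => l * R.A k)
          (fun t y => exp (l * R.A k * t / 2) •
            v ((exp (l * R.A k * t) - 1) / (l * R.A k)) (exp (l * R.A k * t / 2) • y))
          (fun t y => exp (-(l * R.A k * t)) •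
            w ((exp (l * R.A k * t) - 1) / (l * R.A k)) (exp (l * R.A k * t / 2) • y)) 0)
          (embedXY y + z₀ • eZ) 2) * (l * R.A k) / (8 * π * ρ) ≤ A := by
  have hγ : 0 < l * R.A k := mul_pos hl (R.A_pos k)
  have h := curl_lundgren_const_peak_floor_of_budget hγ one_pos hS' hv hω hBS hw hmaps h0 ht ht0 z₀ z
    hpos hΓ hρ hfat (by rw [div_div_eq_mul_div, div_one]; exact hbud) hA
  simpa only [mul_one] using h

end Summit.NavierStokesRegularity.FluidComputer.PalasekTowerClayBridge
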